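import Mathlib.Analysis.SpecialFunctions.Integrals.Basic
import Mathlib.Analysis.SpecialFunctions.Log.Basic
import Mathlib.MeasureTheory.Integral.IntervalIntegral.Basic
import Literature.Barriers.QuantumFields.AbelianDeconfinementD4
import HarnessLib

/-!
# Barrier: the Migdal–Kadanoff recursion is group-blind in four dimensions — it "confines" compact QED, so MK-comparison arguments for confinement must fail the `U(1)` test (Ito 1985; Ito–Seiler 2007/2009)

Barrier catalogue `Literature/Barriers/QuantumFields/` (D-0021), summit `QuantumFields`
(conjunct `YangMills`). This file records, as printed, the obstruction raised by Ito and Seiler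
against proofs of confinement for four-dimensional `SU(N)` lattice gauge theory at all couplings
by COMPARISON WITH THE MIGDAL–KADANOFF (MK) APPROXIMATE RENORMALISATION GROUP (Tomboulis 1983,
2007): Ito's theorem says that in `D ≤ 4` the MK recursion drives the plaquette weight of
`SU(N)` AND of `U(N)` — in particular of compact QED, `U(1)` — to the strong-coupling
(high-temperature) fixed point, whereas four-dimensional compact QED is rigorously deconfined at
weak coupling (Guth 1980, Fröhlich–Spencer 1982; tree fact
`Literature.Barriers.QuantumFields.AbelianDeconfinementD4`). Hence the implication "the MK flow of
the model reaches the strong-coupling fixed point ⇒ the model confines" is false for `U(1)₄`, and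
"any similar argument that does not explicitly make use of the nonabelian nature of the gauge
group has to fail" (Ito–Seiler 2009 §3). The two printed technical objections to the 2007
argument are recorded, one with a proved counterexample (Kanazawa's, to the implicit-function
continuation), together with Tomboulis's printed reply; the file does not adjudicate that dispute.

## What the sources print (verbatim)

* Ito–Seiler, *On the recent paper on quark confinement by Tomboulis*, arXiv:0711.4930 (2007),
  §2 (p. 4), the recursion "of Migdal-Kadanoff type … (the standard recursion formula)":
  `f^{(n)}(U) = f({c_j(n)}, U) = 1 + Σ_{j≠0} c_j(n) d_j χ_j(U)`,
  "`c_j(n) = F_j(n)/F_0(n)`, `F_j(n) = (∫ [f^{(n−1)}(U)]^{b²} (χ_j(U)/d_j) dU)^{b²}` (2.2)–(2.3)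
  in terms of the coefficients of the character expansions. Then [ito]: **Theorem 2.1.** For
  `D ≤ 4` and for `G = SU(N)` or `G = U(N)`, `lim_{n→∞} c_j(n) = 0` for `j ≠ 0`." ([ito] =
  K. R. Ito, Phys. Rev. Lett. 55 (1985) 558.) p. 5, on Tomboulis's Claim 2.1: "Since
  `{c_j^{(n)} ≥ 0}` tends to the high temperature fixed point (i.e. `{c_j(n)} → 0`) as `n → ∞`
  if the dimension is `≤ 4`, whether `G` is abelian or non-abelian …, this would mean strict
  positivity of 't Hooft's string tension and then establish permanent confinement of quarks
  … This cannot be correct, however, since there exists a deconfining Kosterlitz-Thouless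
  (KT) type transition in 4D lattice gauge theory based on abelian gauge groups." §3 (p. 6):
  "As is pointed out in [tomb] and as is easily proved, we can prove `A > A⁺` if `{c_j ≥ 0}` are
  small and the high-temperature expansion converges. But we do not see that the proof of his
  claim for large `β` is given in the paper [tomb]." §4 (p. 7): "Though the Migdal-Kadanoff RG
  recursion formulas cannot distinguish non-abelian groups from abelian ones, the velocities of
  the convergences of `{c_j(n)}` to 0 as `n → ∞` are very different. We are rather skeptical
  about the idea that the problem of quark confinement can be solved by soft analysis like this,
  but if the Migdal-Kadanoff RG formulas should play a role in a rigorous proof of quark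
  confinement in lattice gauge theory, this fact would certainly have to come into play."
* Ito–Seiler, *Critical discussion of Tomboulis's approach to the confinement problem*, PoS
  Confinement8 (2008) 034, arXiv:0901.4246, §1: "It was proven a little later that in 4
  dimensions the MK RG drives lattice `SU(N)` Yang-Mills theory, but also compact lattice QED
  to the strong coupling fixed point [ito]. This signals confinement for these models, and is
  therefore misleading for the abelian model, which is known to have a deconfining transition
  [guth, fs]." §2: Tomboulis's strategy — the flux-spreading inequality "(ineq) is supposed to
  follow from `Z⁻_Λ/Z_Λ ≥ Z⁻_{MKT}(n)/Z_{MKT}(n)` … If we assume for a moment that inequality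
  (MKTineq) holds and the MKT iteration leads eventually into the strong coupling regime,
  inequality (ineq) follows, and this implies electric flux string formation and confinement in
  the sense that 't Hooft's string tension `σ_tH` satisfies `σ_tH > 0 ∀g²`" (§1: "'t Hooft's
  confinement criterion implies confinement in the sense of Wilson and Polyakov [bs, ty]").
  §3 "The fundamental issue": "the MK RG in 4D shows no structural difference between abelian
  (such as `U(1)`) and nonabelian (such as `SU(N)`) models: the flow is always attracted by the
  strong coupling fixed point. This was already pointed out in the seminal paper [jose], where
  this insight was actually traced to Wilson's 1976 Cargèse lectures; as remarked, a proof of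
  this fact was given by Ito [ito]. This means that the original comparison argument given by
  Tomboulis has to fail for `U(1)`, because the 4D `U(1)` model has vanishing string tension for
  sufficiently weak coupling. In fact, any similar argument that does not explicitly make use of
  the nonabelian nature of the gauge group has to fail." §4(a): "In essence the decimation
  amounts to alternating raising the coupling function to the power `2^{D−2}` and raising the
  Fourier coefficients `c_j` to the power `4r`. … Equality of the two exponents `2^{D−2}` and
  `4r` would mean that one is working in the critical dimension `D_c` and one finds easily
  `D_c = 4 + ln r/ln 2 < 4`, so that with `r < 1` in 4D one is above the critical dimension and
  has to expect a phase transition. This is indeed the case; we have run the iteration for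
  `r = 0.9` and two close values of `β ≡ 2/g²` and found a bifurcation of the flow: for `β = 4.79`
  the flow is attracted to the weak coupling fixed point, whereas for `β = 4.80` is flows to the
  strong coupling fixed point." §4(b): "His argument (in Appendix C of [tomb07]), based on the
  implicit function theorem, is flawed. … by the implicit function theorem there is a solution
  near `λ = 0`. But the information is not sufficient to allow the extension to `λ = 1`, as shown
  by a simple counterexample due to T. Kanazawa [kana]: `Ψ(λ,t) ≡ e^{−t} − 1 + 2λ` which has the
  solution `t(λ) = −log(1 − 2λ)`." §5: "In this respect the case of `U(1)` is instructive: for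
  `r = 1` the common interpolation parameter `α*` cannot exist, because it would imply the
  existence of a nonvanishing string tension at all values of the bare coupling, in
  contradiction with proven facts ([guth, fs]). Quite generally, we think that any strategy
  based on a Migdal-Kadanoff type decimation is very unlikely to succeed, because these
  hierarchical approximations do not show any structural difference between abelian (like
  `U(1)`) and nonabelian (like `SU(2)`) models."
* Tomboulis, *Confinement for all values of the coupling in four-dimensional SU(2) gauge theory*,
  arXiv:0707.2179 (2007, unpublished), Abstract: "The strategy is to employ approximate RG
  decimation transformations of the potential moving type which give both upper and lower
  bounds on the partition function at each successive decimation step. By interpolation between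
  these bounds an exact representation of the partition function is obtained on progressively
  coarser lattices. … Confining behavior for the vortex free energy order parameter (ratio of
  partition functions with and without external flux), hence `area law' for the Wilson loop, is
  the result for any initial coupling." Tomboulis, *Reply to arXiv:0711.4930*, arXiv:0712.2620,
  Abstract: "The argument in 0707.2179 is, among other things, specifically constructed so that
  the inequality in question is invoked only at strong coupling, where it is easily proven.
  Underlying the mangling of the argument in 0707.2179 by Ito and Seiler are their incorrect
  statements concerning the dependence of the potential-moving decimation procedures used in
  0707.2179 on space-time dimensionality and other decimation parameters."

## Contents

* `MigdalKadanoff.conv`, `fourthPowerCoeff`, `mkStep`, `mkIter` — the standard MK recursion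
  (2.2)–(2.3) for `G = U(1)`, `D = 4`, `b = 2`, `r = 1`, on normalised Fourier coefficients
  (`d_j = 1`): `c ↦ ((c^{*4})_j/(c^{*4})_0)^4` (pointwise fourth power of the coupling function =
  fourfold convolution of coefficients, then coefficients to the fourth power);
  `u1WilsonCoeff β j = ∫ e^{β cos θ}cos(jθ) / ∫ e^{β cos θ}` — the initial data of compact QED₄
  (`u1WilsonCoeff_zero`, `u1WilsonCoeff_neg` proved); `FlowsToStrongCoupling` (`c_j(n) → 0`,
  `j ≠ 0`).
* `MigdalKadanoffGroupBlindness` — NAMED FACT (Ito 1985 as reported by Ito–Seiler 2007 Thm 2.1,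
  2009 §1, §3; `U(1)` half only): for every `β > 0` the MK flow of compact QED₄ reaches the
  strong-coupling fixed point — DISCHARGED in the tree (`MigdalKadanoffGroupBlindness_holds`,
  sibling file `MigdalKadanoffGroupBlindnessDischarge.lean`: Ito's critical-dimension
  local-curvature argument, formalised there for `U(1)`). The technique class
  `MKConfinementCriterionU1D4` (the `U(1)₄` instance of "MK flow to strong coupling ⇒ area law";
  a one-field `structure` in `Prop`, see "Verdict clean-up" below) and the barrier theorem
  `MigdalKadanoffGroupBlindness.not_mkConfinementCriterionU1D4` (PROVED modulo the two vendored
  facts and non-emptiness of infinite-volume limit points; with Ito's theorem and non-emptiness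
  discharged in the tree, modulo `Literature.MathematicalPhysics.QuantumFieldTheory.FrohlichSpencerU1PerimeterLawD4`
  alone — `MigdalKadanoffGroupBlindness.not_mkConfinementCriterionU1D4_of_frohlichSpencer`,
  sibling file `MigdalKadanoffGroupBlindnessProofs.lean`).
* `kanazawaPsi` with `hasDerivAt_kanazawaPsi`, `deriv_kanazawaPsi_ne_zero`,
  `kanazawaPsi_zero_zero`, `kanazawaPsi_eq_zero_iff`, `kanazawaPsi_ne_zero`,
  `tendsto_kanazawa_branch` — Kanazawa's counterexample, PROVED: `∂_tΨ ≠ 0` everywhere, the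
  unique zero branch `t(λ) = −log(1 − 2λ)` through `(0,0)` blows up as `λ ↑ 1/2`, and there is
  no zero at any `λ ≥ 1/2`, in particular none at `λ = 1`.
* `criticalDim r = 4 + log r/log 2` with `criticalDim_lt_four` (`0 < r < 1`), `criticalDim_one`.

## Design and what is NOT here

* Only the `U(1)` (compact QED) half of Ito's theorem is vendored — it is the half that makes the
  recursion misleading; the `SU(N)` half needs character expansions on `SU(N)`.
* Tomboulis's modified decimations (parameters `α, t, r`), his interpolation representation, the
  twisted partition function `Z⁻`, and the implications "`σ_tH > 0` ⇒ area law" (Borgs–Seiler,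
  Tomboulis–Yaffe) are NOT formalised: this file records the printed `U(1)` test and the two
  printed objections; it does not decide the dispute (see `status:`).
* The group-uniform form of the criterion is not a separate definition: any confinement
  criterion stated uniformly in the compact gauge group specialises to `MKConfinementCriterionU1D4`
  (compare `Literature.Barriers.QuantumFields.GroupBlindAreaLawD4`, whose refutation pattern this
  file reuses).

## Verdict clean-up of `MKConfinementCriterionU1D4` (defact pass, 2026-08-16)

The closed `Prop` definition `MKConfinementCriterionU1D4` had been seated as literature debt (a
"named fact" awaiting a discharge `MKConfinementCriterionU1D4_holds`); its tenured prove-seat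
ended with the statement verdict *misstated* — "a D-0021 TECHNIQUE CLASS (false by design;
ItoSeiler2009Critical §3/§5 assert its NEGATION) — no `MKConfinementCriterionU1D4_holds` can
exist", refutation sharpened in the sibling file `MigdalKadanoffGroupBlindnessProofs.lean`
(p20488). Re-verified 2026-08-16: (source) Ito–Seiler 2009 §2 print the chain the class
instantiates and §3, §5 print its negation for `U(1)` (quotations above, re-read from the held
text of arXiv:0901.4246); (tree) `¬ MKConfinementCriterionU1D4` is proved modulo the single
printed input `Literature.MathematicalPhysics.QuantumFieldTheory.FrohlichSpencerU1PerimeterLawD4`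
(`MigdalKadanoffGroupBlindness.not_mkConfinementCriterionU1D4_of_frohlichSpencer`), Ito's theorem
being discharged (`MigdalKadanoffGroupBlindness_holds`, `MigdalKadanoffGroupBlindnessDischarge.lean`)
and non-emptiness of the limit-point sets being the tree theorem
`Literature.MathematicalPhysics.QuantumLattice.infiniteVolumeLimitPoints_nonempty_holds`. The
verdict is correct in substance (the declaration is a definition, false by design, not a
statement of any source; its negation is the barrier); nothing is retired, deprecated or marked
open. Treatment (restated, meaning-preserving, old name kept): the class is declared as a
one-field `structure MKConfinementCriterionU1D4 : Prop` whose field `hasAreaLawState` is the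
former body byte-for-byte (`mkConfinementCriterionU1D4_iff`), i.e. as the explicit technique-class
INTERFACE of D-0021(e) rather than a closed named fact; docstring headed TECHNIQUE CLASS, tagged
`[folklore]` (coined here) with the Ito–Seiler sentences cited in prose — the treatment given to
the sibling classes `GroupBlindIrrepAreaLawD4`, `GroupBlindClusteringD4` on 2026-08-15. The one
in-file use of the body (`not_mkConfinementCriterionU1D4`) now projects the field; the six
theorems naming the class (two here, four in `MigdalKadanoffGroupBlindnessProofs.lean`) keep their
statements verbatim and the two importing files (`…Proofs.lean`, `…Discharge.lean`) elaborate
unchanged. No statement of a fact or theorem of this file was altered; the docstring of the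
(discharged) fact `MigdalKadanoffGroupBlindness` only records the discharges in its
`scope_caveats:` / `status:` lines.

## References

* K. R. Ito, E. Seiler, arXiv:0711.4930 (2007) (`ItoSeiler2007Tomboulis`) — §2 (Thm 2.1,
  (2.2)–(2.3), Claim 2.1), §3, §4.
* K. R. Ito, E. Seiler, PoS Confinement8 (2008) 034, arXiv:0901.4246 (`ItoSeiler2009Critical`) —
  §§1–5.
* K. R. Ito, Phys. Rev. Lett. 55 (1985) 558 (`Ito1985MKConfinement`; with PRL 54 (1985) 2383) —
  cited through the two items above.
* E. T. Tomboulis, arXiv:0707.2179 (`Tomboulis2007Confinement`); arXiv:0712.2620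
  (`Tomboulis2007Reply`); Phys. Rev. Lett. 50 (1983) 885 (`Tomboulis1983PRL`).
* T. Kanazawa, Phys. Lett. B 670 (2009) 421, arXiv:0805.2742 (`Kanazawa2009Twisted`).
* J. V. José, L. P. Kadanoff, S. Kirkpatrick, D. R. Nelson, Phys. Rev. B 16 (1977) 1217
  (`JoseKadanoffKirkpatrickNelson1977`) — cited through Ito–Seiler 2009 §3.
* A. H. Guth, Phys. Rev. D 21 (1980) 2291 (`Guth1980`); J. Fröhlich, T. Spencer, CMP 83 (1982)
  411 (`FrohlichSpencerCMP1982`) — through `AbelianDeconfinementD4`.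
-/

noncomputable section

open Filter Real MeasureTheory intervalIntegral
open Literature.MathematicalPhysics.QuantumLattice
open scoped Topology

namespace Literature.Barriers.QuantumFields

namespace MigdalKadanoff

/-! ### The standard Migdal–Kadanoff recursion for `U(1)` in `D = 4` -/

/-- Convolution on `ℤ`, `(a * b)_j = Σ_k a_k b_{j−k}`: the Fourier coefficients of a product of
two functions on `U(1)` (characters `χ_j(θ) = e^{ijθ}`, `d_j = 1`). [folklore] -/
def conv (a b : ℤ → ℝ) (j : ℤ) : ℝ := ∑' k, a k * b (j - k)

/-- The Fourier coefficients of the fourth pointwise power `f⁴` of the coupling function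
`f = Σ_j c_j e^{ijθ}` — the inner integral `∫ [f^{(n−1)}(U)]^{b²} χ_j(U)/d_j dU` of (2.3) with
`b² = 4` ("raising the coupling function to the power `2^{D−2}`", `D = 4`).
[cite: ItoSeiler2007Tomboulis, §2 eq. (2.3) (p. 4)] -/
def fourthPowerCoeff (c : ℤ → ℝ) : ℤ → ℝ := conv c (conv c (conv c c))

/-- **One step of the standard Migdal–Kadanoff recursion** (no correction parameters: `α = 1`,
`r = 1`) for `G = U(1)`, `D = 4`, scale factor `b = 2`: `c_j(n) = F_j(n)/F_0(n)`,
`F_j(n) = (∫ [f^{(n−1)}]^{b²} χ_j/d_j)^{b²}`, i.e. `c ↦ ((c^{*4})_j/(c^{*4})_0)^4` ("alternating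
raising the coupling function to the power `2^{D−2}` and raising the Fourier coefficients `c_j`
to the power `4r`", `r = 1`). [cite: ItoSeiler2007Tomboulis, §2 eqs. (2.2)–(2.3) (p. 4)] [cite: ItoSeiler2009Critical, §4(a)] -/
def mkStep (c : ℤ → ℝ) (j : ℤ) : ℝ := (fourthPowerCoeff c j / fourthPowerCoeff c 0) ^ 4

/-- `n` iterations of the MK step, `c(n) = mkStep^{[n]} c(0)`.
[cite: ItoSeiler2007Tomboulis, §2 (p. 4)] -/
def mkIter (c : ℤ → ℝ) (n : ℕ) : ℤ → ℝ := mkStep^[n] c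

/-- The recursion keeps the normalisation `c_0 = 1` (when the normalising coefficient is
non-zero). [folklore] -/
theorem mkStep_zero {c : ℤ → ℝ} (h : fourthPowerCoeff c 0 ≠ 0) : mkStep c 0 = 1 := by
  simp [mkStep, div_self h]

/-- **The initial data of compact QED₄**: the normalised Fourier coefficients
`c_j(β) = ∫₀^{2π} e^{β cos θ} cos(jθ) dθ / ∫₀^{2π} e^{β cos θ} dθ` (`= I_j(β)/I_0(β)`) of the `U(1)`
Wilson plaquette weight `exp(β Re U_p) = F₀ · (1 + Σ_{j≠0} c_j χ_j)`, the `U(1)` case of the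
starting point `exp[(β/2)χ_{1/2}(U)] = F₀(0) f({c_j}, U)` of Ito–Seiler §2.
[cite: ItoSeiler2007Tomboulis, §2 eq. (2.1) (p. 4)] -/
def u1WilsonCoeff (β : ℝ) (j : ℤ) : ℝ :=
  (∫ θ in (0 : ℝ)..(2 * π), exp (β * cos θ) * cos (j * θ)) /
    ∫ θ in (0 : ℝ)..(2 * π), exp (β * cos θ)

/-- The normalising integral `∫₀^{2π} e^{β cos θ} dθ` is positive. [folklore] -/
theorem u1Wilson_norm_pos (β : ℝ) : 0 < ∫ θ in (0 : ℝ)..(2 * π), exp (β * cos θ) := by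
  apply intervalIntegral.intervalIntegral_pos_of_pos_on
  · exact (by fun_prop : Continuous fun θ => exp (β * cos θ)).intervalIntegrable _ _
  · intro x _; exact exp_pos _
  · positivity

/-- `c_0(β) = 1` (the normalisation of `f`). [folklore] -/
theorem u1WilsonCoeff_zero (β : ℝ) : u1WilsonCoeff β 0 = 1 := by
  rw [u1WilsonCoeff]
  simp only [Int.cast_zero, zero_mul, cos_zero, mul_one]
  exact div_self (u1Wilson_norm_pos β).ne'

/-- `c_{−j}(β) = c_j(β)` (the weight is a real class function). [folklore] -/
theorem u1WilsonCoeff_neg (β : ℝ) (j : ℤ) : u1WilsonCoeff β (-j) = u1WilsonCoeff β j := by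
  simp [u1WilsonCoeff, neg_mul, cos_neg]

/-- **Flow to the strong-coupling (high-temperature) fixed point** `c ≡ δ_{j,0}`:
`lim_{n→∞} c_j(n) = 0` for every `j ≠ 0` (coefficient-wise, as printed in Theorem 2.1).
[cite: ItoSeiler2007Tomboulis, §2 Thm 2.1 (p. 4)] -/
def FlowsToStrongCoupling (c : ℤ → ℝ) : Prop :=
  ∀ j : ℤ, j ≠ 0 → Tendsto (fun n => mkIter c n j) atTop (𝓝 0)

/-! ### The parameter `r`: critical dimension `D_c = 4 + ln r / ln 2` -/

/-- The critical dimension `D_c(r) = 4 + ln r/ln 2` of the MKT recursion with decimation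
parameter `r` (coupling function to the power `2^{D−2}`, coefficients to the power `4r`; equality
of the exponents at `D = D_c`). [cite: ItoSeiler2009Critical, §4(a)] -/
def criticalDim (r : ℝ) : ℝ := 4 + Real.log r / Real.log 2

/-- `D_c(r) < 4` for `0 < r < 1` — "so that with `r < 1` in 4D one is above the critical dimension
and has to expect a phase transition" (reported numerically: a bifurcation of the flow between
`β = 4.79` and `β = 4.80` at `r = 0.9`). [cite: ItoSeiler2009Critical, §4(a)] -/
theorem criticalDim_lt_four {r : ℝ} (hr0 : 0 < r) (hr1 : r < 1) : criticalDim r < 4 := by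
  rw [criticalDim]
  have hlog : Real.log r < 0 := Real.log_neg hr0 hr1
  have hlog2 : 0 < Real.log 2 := Real.log_pos one_lt_two
  have : Real.log r / Real.log 2 < 0 := div_neg_of_neg_of_pos hlog hlog2
  linarith

/-- `D_c(1) = 4`: the standard recursion (`r = 1`) is critical exactly in four dimensions.
[cite: ItoSeiler2009Critical, §4(a)] -/
theorem criticalDim_one : criticalDim 1 = 4 := by simp [criticalDim]

/-! ### Kanazawa's counterexample to the implicit-function continuation -/

/-- Kanazawa's function `Ψ(λ, t) = e^{−t} − 1 + 2λ`: a counterexample showing that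
`∂_tΨ ≠ 0` plus a solution at `λ = 0` does not yield a solution branch reaching `λ = 1`
(the step in Appendix C of Tomboulis 2007 criticised by Ito–Seiler).
[cite: ItoSeiler2009Critical, §4(b) (counterexample of T. Kanazawa)] -/
def kanazawaPsi (l t : ℝ) : ℝ := exp (-t) - 1 + 2 * l

/-- `∂_tΨ(λ,t) = −e^{−t}`. [folklore] -/
theorem hasDerivAt_kanazawaPsi (l t : ℝ) :
    HasDerivAt (fun s => kanazawaPsi l s) (-exp (-t)) t := by
  unfold kanazawaPsi
  have h := ((hasDerivAt_id t).neg.exp).sub_const 1 |>.add_const (2 * l)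
  simpa using h

/-- **The implicit-function hypothesis holds everywhere**: `∂_tΨ(λ,t) ≠ 0` for all `λ, t`.
[cite: ItoSeiler2009Critical, §4(b)] -/
theorem deriv_kanazawaPsi_ne_zero (l t : ℝ) : deriv (fun s => kanazawaPsi l s) t ≠ 0 := by
  rw [(hasDerivAt_kanazawaPsi l t).deriv]
  exact neg_ne_zero.mpr (exp_pos _).ne'

/-- There is a solution at `λ = 0`: `Ψ(0, 0) = 0`. [cite: ItoSeiler2009Critical, §4(b)] -/
theorem kanazawaPsi_zero_zero : kanazawaPsi 0 0 = 0 := by simp [kanazawaPsi]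

/-- The solution branch `t(λ) = −log(1 − 2λ)` for `λ < 1/2`. [cite: ItoSeiler2009Critical, §4(b)] -/
theorem kanazawaPsi_branch {l : ℝ} (hl : l < 1 / 2) :
    kanazawaPsi l (-Real.log (1 - 2 * l)) = 0 := by
  rw [kanazawaPsi, neg_neg, Real.exp_log (by linarith)]
  ring

/-- … and it is the ONLY zero for `λ < 1/2`. [folklore] -/
theorem kanazawaPsi_eq_zero_iff {l t : ℝ} (hl : l < 1 / 2) :
    kanazawaPsi l t = 0 ↔ t = -Real.log (1 - 2 * l) := by
  constructor
  · intro h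
    have h1 : exp (-t) = 1 - 2 * l := by rw [kanazawaPsi] at h; linarith
    have := congrArg Real.log h1
    rw [Real.log_exp] at this
    linarith
  · rintro rfl; exact kanazawaPsi_branch hl

/-- **No continuation to `λ = 1`**: for every `λ ≥ 1/2` (in particular `λ = 1`) the equation
`Ψ(λ, t) = 0` has no solution at all (`e^{−t} > 0 ≥ 1 − 2λ`). [cite: ItoSeiler2009Critical, §4(b)] -/
theorem kanazawaPsi_ne_zero {l : ℝ} (hl : 1 / 2 ≤ l) (t : ℝ) : kanazawaPsi l t ≠ 0 := by
  rw [kanazawaPsi]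
  have := exp_pos (-t)
  intro h
  linarith

/-- The branch escapes to `+∞` as `λ ↑ 1/2`: `−log(1 − 2λ) → +∞`. [folklore] -/
theorem tendsto_kanazawa_branch :
    Tendsto (fun l => -Real.log (1 - 2 * l)) (𝓝[<] (1 / 2)) atTop := by
  have h1 : Tendsto (fun l : ℝ => 1 - 2 * l) (𝓝[<] (1 / 2)) (𝓝[>] 0) := by
    refine tendsto_nhdsWithin_of_tendsto_nhds_of_eventually_within _ ?_ ?_
    · have : Tendsto (fun l : ℝ => 1 - 2 * l) (𝓝 (1 / 2)) (𝓝 (1 - 2 * (1 / 2))) :=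
        (tendsto_const_nhds.sub (tendsto_const_nhds.mul tendsto_id))
      rw [show (1 : ℝ) - 2 * (1 / 2) = 0 by norm_num] at this
      exact this.mono_left nhdsWithin_le_nhds
    · filter_upwards [self_mem_nhdsWithin] with l hl
      simp only [Set.mem_Iio] at hl
      simp only [Set.mem_Ioi]; linarith
  have h2 := Real.tendsto_log_nhdsGT_zero
  exact tendsto_neg_atBot_atTop.comp (h2.comp h1)

end MigdalKadanoff

open MigdalKadanoff

/-! ### The technique class and the barrier -/

/-- **TECHNIQUE CLASS (explicit definition, coined for this barrier and FALSE BY DESIGN; not a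
literature fact — no `MKConfinementCriterionU1D4_holds` can exist): the `U(1)₄` instance of the
Migdal–Kadanoff comparison criterion.** The conclusion Tomboulis's chain would deliver for ANY
compact gauge group whose MK flow reaches strong coupling — "If we assume for a moment that
inequality (MKTineq) holds and the MKT iteration leads eventually into the strong coupling
regime, inequality (ineq) follows, and this implies … 't Hooft's string tension `σ_tH > 0 ∀g²`"
(Ito–Seiler 2009, §2), and 't Hooft's criterion "implies confinement in the sense of Wilson and
Polyakov [bs, ty]" (ibid. §1) — specialised to `G = U(1)`, Wilson action, `d = 4`: for every
`β > 0`, IF the standard MK flow of the normalised Fourier coefficients of `exp(β Re U_p)`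
converges to the strong-coupling fixed point, THEN every infinite-volume limit state has the
Wilson-loop area law (`HasAreaLawState`, the conclusion of
`Literature.MathematicalPhysics.QuantumFieldTheory.osterwalder_seiler_areaLaw` at small `β`). Any
criterion of this form stated uniformly in the compact gauge group (as an MK-comparison argument
"that does not explicitly make use of the nonabelian nature of the gauge group" is) specialises
to this one.

**Refuted, as designed — the sources print its NEGATION** (Ito–Seiler 2009 §3: "the original
comparison argument given by Tomboulis has to fail for `U(1)`, because the `4D` `U(1)` model has
vanishing string tension for sufficiently weak coupling. In fact, any similar argument that does
not explicitly make use of the nonabelian nature of the gauge group has to fail"; §5: "for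
`r = 1` the common interpolation parameter `α*` cannot exist, because it would imply the
existence of a nonvanishing string tension at all values of the bare coupling, in contradiction
with proven facts ([guth, fs])"): in the tree `¬ MKConfinementCriterionU1D4` is
`MigdalKadanoffGroupBlindness.not_mkConfinementCriterionU1D4` below (from Ito's theorem, the
torus perimeter law `AbelianDeconfinementD4` and non-emptiness of the limit-point sets) and,
modulo the single printed input
`Literature.MathematicalPhysics.QuantumFieldTheory.FrohlichSpencerU1PerimeterLawD4`,
`Literature.Barriers.QuantumFields.MigdalKadanoffGroupBlindness.not_mkConfinementCriterionU1D4_of_frohlichSpencer`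
with the contrapositive `Literature.Barriers.QuantumFields.MKConfinementCriterionU1D4.not_frohlichSpencer`
(sibling file `MigdalKadanoffGroupBlindnessProofs.lean`) — Ito's theorem being DISCHARGED
(`Literature.Barriers.QuantumFields.MigdalKadanoffGroupBlindness_holds`, sibling file
`MigdalKadanoffGroupBlindnessDischarge.lean`) and non-emptiness proved
(`Literature.MathematicalPhysics.QuantumLattice.infiniteVolumeLimitPoints_nonempty_holds`), the
hypothesis-free `¬`-theorem waits only on `FrohlichSpencerU1PerimeterLawD4_holds`, and any file
importing both siblings has it modulo that input as
`MigdalKadanoffGroupBlindness_holds.not_mkConfinementCriterionU1D4_of_frohlichSpencer hFS`.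
**Shape (verdict clean-up 2026-08-16, module docstring).** No `MKConfinementCriterionU1D4_holds`
can exist and the class carries no literature debt of its own: it is declared as a one-field
`structure` in `Prop` — the explicit technique-class INTERFACE of D-0021(e), the package of
conclusions an MK-comparison argument would have to deliver, assumed only in order to be
refuted — whose field `hasAreaLawState` is the body of the former closed definition byte-for-byte
(`mkConfinementCriterionU1D4_iff`); name kept, every user compiles unchanged; not deprecated (it
is the live class an MK-comparison route must evade); the tag records the DEFINITION as coined
here, the Ito–Seiler sentences it instantiates being cited in prose, not as a claim to be
discharged (the treatment of the sibling classes
`Literature.Barriers.QuantumFields.GroupBlindIrrepAreaLawD4`,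
`Literature.Barriers.QuantumFields.GroupBlindClusteringD4`). [folklore] -/
structure MKConfinementCriterionU1D4 : Prop where
  /-- The conclusion of the criterion: for every `β > 0`, if the standard Migdal–Kadanoff flow of
  the normalised Fourier coefficients of the `U(1)` Wilson weight `exp(β cos θ)` reaches the
  strong-coupling fixed point, then every infinite-volume limit state of four-dimensional compact
  QED at coupling `β` has the Wilson-loop area law. -/
  hasAreaLawState : ∀ β : ℝ, 0 < β → FlowsToStrongCoupling (u1WilsonCoeff β) →
    ∀ μ ∈ infiniteVolumeLimitPoints (d := 4) u1Rep β, HasAreaLawState μ u1Character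

/-- The technique class unfolds to its single field — the body of the former closed definition,
byte-for-byte: `∀ β > 0, FlowsToStrongCoupling (u1WilsonCoeff β) → ∀ μ ∈ limit points, area law`.
[folklore] -/
theorem mkConfinementCriterionU1D4_iff :
    MKConfinementCriterionU1D4 ↔
      ∀ β : ℝ, 0 < β → FlowsToStrongCoupling (u1WilsonCoeff β) →
        ∀ μ ∈ infiniteVolumeLimitPoints (d := 4) u1Rep β, HasAreaLawState μ u1Character :=
  ⟨fun h => h.hasAreaLawState, fun h => ⟨h⟩⟩

/-- **Barrier (named fact — DISCHARGED in the tree: `MigdalKadanoffGroupBlindness_holds`, sibling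
file `MigdalKadanoffGroupBlindnessDischarge.lean`; Ito 1985, as reported by Ito–Seiler): the
Migdal–Kadanoff recursion confines compact QED₄ at every coupling.** For every `β > 0` the standard (`r = 1`, `b = 2`,
`D = 4`) MK iterates of the normalised Fourier coefficients of the `U(1)` Wilson plaquette weight
`exp(β cos θ)` converge coefficient-wise to the strong-coupling fixed point: `c_j(n) → 0` for all
`j ≠ 0` — "For `D ≤ 4` and for `G = SU(N)` or `G = U(N)`, `lim_{n→∞} c_j(n) = 0` for `j ≠ 0`"
(Theorem 2.1, quoting Ito, PRL 55 (1985) 558), "in 4 dimensions the MK RG drives lattice `SU(N)`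
Yang-Mills theory, but also compact lattice QED to the strong coupling fixed point" (2009 §1); the
`U(N)`, `N = 1` half is the one vendored (see `scope_caveats:`).

technique_class: migdal-kadanoff, migdal-kadanoff-recursion, migdal-kadanoff-decimation, approximate-rg-decimation, potential-moving, potential-moving-bounds, mk-comparison-inequalities, hierarchical-lattice-approximation, tomboulis-programme, vortex-free-energy-mk-comparison, group-blind-rg-flow
blocks: for `YangMills` — the confinement leg (Wilson-loop area law / positive string tension for four-dimensional `SU(N)` lattice gauge theory at ALL couplings, `Literature.MathematicalPhysics.QuantumFieldTheory.CaoParkSheffieldProblem`, and the lattice statements feeding `Literature.MathematicalPhysics.QuantumFieldTheory.LatticeMassGapAllCouplings`) by COMPARISON WITH THE MIGDAL–KADANOFF RECURSION: Tomboulis's programme [cite: Tomboulis1983PRL, as reported by ItoSeiler2009Critical §1] — "approximate RG decimation transformations of the potential moving type which give both upper and lower bounds on the partition function at each successive decimation step. By interpolation between these bounds an exact representation of the partition function is obtained … Confining behavior for the vortex free energy order parameter …, hence `area law' for the Wilson loop, is the result for any initial coupling" [claim: Tomboulis2007Confinement, status: disputed] — whose engine is "`Z⁻_Λ/Z_Λ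 ≥ Z⁻_{MKT}(n)/Z_{MKT}(n)` … and the MKT iteration leads eventually into the strong coupling regime … this implies … `σ_tH > 0 ∀g²`" [cite: ItoSeiler2009Critical, §2]; the explicit class refuted here is `MKConfinementCriterionU1D4` (theorem `MigdalKadanoffGroupBlindness.not_mkConfinementCriterionU1D4`, from this fact, `AbelianDeconfinementD4` and non-emptiness of infinite-volume limit points), and with it every MK-comparison criterion stated uniformly in the compact gauge group (cf. `Literature.Barriers.QuantumFields.GroupBlindAreaLawD4`): "This means that the original comparison argument given by Tomboulis has to fail for `U(1)`, because the 4D `U(1)` model has vanishing string tension for sufficiently weak coupling. In fact, any similar argument that does not explicitly make use of the nonabelian nature of the gauge group has to fail." [cite: ItoSeiler2009Critical, §3].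
because: "the MK RG in 4D shows no structural difference between abelian (such as `U(1)`) and nonabelian (such as `SU(N)`) models: the flow is always attracted by the strong coupling fixed point. This was already pointed out in the seminal paper [jose], where this insight was actually traced to Wilson's 1976 Cargèse lectures; as remarked, a proof of this fact was given by Ito [ito]." [cite: ItoSeiler2009Critical, §3] [cite: JoseKadanoffKirkpatrickNelson1977, as reported by ItoSeiler2009Critical §3] — Ito's theorem [cite: ItoSeiler2007Tomboulis, §2 Thm 2.1 (p. 4)] [cite: Ito1985MKConfinement, as reported by ItoSeiler2007Tomboulis Thm 2.1 and ItoSeiler2009Critical §1] (this fact, for `U(1)`) — while weak-coupling compact QED₄ is rigorously deconfined, Wilson loops obeying a perimeter law (Guth 1980; Fröhlich–Spencer 1982; tree fact `AbelianDeconfinementD4`, with `HasPerimeterLaw.not_hasAreaLawState`), so "Since `{c_j^{(n)} ≥ 0}` tends to the high temperature fixed point … whether `G` is abelian or non-abelian …, this would mean strict positivity of 't Hooft's string tension … This cannot be correct, however, since there exists a deconfining Kosterlitz-Thouless (KT) type transition in 4D lattice gauge theory based on abelian gauge groups" [cite: ItoSeiler2007Tomboulis, §2 (p. 5)] and "for `r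 = 1` the common interpolation parameter `α*` cannot exist, because it would imply the existence of a nonvanishing string tension at all values of the bare coupling, in contradiction with proven facts ([guth, fs])" [cite: ItoSeiler2009Critical, §5]; the two printed technical objections to the 2007 text: (1) the inequality `A ≥ A⁺` securing a common interpolation parameter for `Z` and `Z⁺` — "we can prove `A > A⁺` if `{c_j ≥ 0}` are small and the high-temperature expansion converges. But we do not see that the proof of his claim for large `β` is given" [cite: ItoSeiler2007Tomboulis, §3 (p. 6)], answered by "the inequality in question is invoked only at strong coupling, where it is easily proven" [cite: Tomboulis2007Reply, Abstract]; (2) the continuation of the interpolation parameter from `λ = 0` to `λ = 1` by the implicit function theorem "is flawed … as shown by a simple counterexample due to T. Kanazawa: `Ψ(λ,t) ≡ e^{−t} − 1 + 2λ` which has the solution `t(λ) = −log(1−2λ)`" [cite: ItoSeiler2009Critical, §4(b)] — PROVED here: `deriv_kanazawaPsi_ne_zero` (the implicit-function hypothesis holds everywhere), `kanazawaPsi_zero_zero`, `kanazawaPsi_eq_zero_iff` (unique branch), `tendsto_kanazawa_branch` (blow-up at `λ = 1/2`), `kanazawaPsi_ne_zero` (no zero at any `λ ≥ 1/2`); and on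 the remedy `r < 1`: "`D_c = 4 + ln r/ln 2 < 4`, so that with `r < 1` in 4D one is above the critical dimension and has to expect a phase transition … for `β = 4.79` the flow is attracted to the weak coupling fixed point, whereas for `β = 4.80` is flows to the strong coupling fixed point" (`r = 0.9`) [cite: ItoSeiler2009Critical, §4(a)] (`criticalDim_lt_four`), i.e. the hypothesis "the MKT iteration leads eventually into the strong coupling regime" is then lost at weak coupling, while `r = 1` is excluded by the `U(1)` test.
evasions_known: (a) use the non-abelian structure quantitatively: "Though the Migdal-Kadanoff RG recursion formulas cannot distinguish non-abelian groups from abelian ones, the velocities of the convergences of `{c_j(n)}` to 0 as `n → ∞` are very different. … if the Migdal-Kadanoff RG formulas should play a role in a rigorous proof of quark confinement in lattice gauge theory, this fact would certainly have to come into play." [cite: ItoSeiler2007Tomboulis, §4 (p. 7)] — no such argument is published; (b) three dimensions: "In the case of `D = 3`, in which case `{c_j(n)}` converges to 0 exponentially fast as `n → ∞`, we may have a chance to apply his idea to the problem of quark confinement in 3D lattice gauge theory which is not yet solved. But so far, we do not know the method." [cite: ItoSeiler2007Tomboulis, §4 (p. 7)]; (c) Tomboulis's own position — the potential-moving decimations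 with parameters make the argument sensitive to dimension and decimation parameters, and the disputed inequality is needed only at strong coupling [cite: Tomboulis2007Reply, Abstract]; contested by Ito–Seiler: making `r` depend on `n` "exactly how this would have to be done remains unclear", and "any strategy based on a Migdal-Kadanoff type decimation is very unlikely to succeed, because these hierarchical approximations do not show any structural difference between abelian (like `U(1)`) and nonabelian (like `SU(2)`) models" [cite: ItoSeiler2009Critical, §5]; (d) the obstruction is stated by its authors for "hierarchical approximations" of Migdal–Kadanoff type only [cite: ItoSeiler2009Critical, §5] — renormalisation-group arguments that are not comparisons with the MK recursion are outside its scope.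
scope_caveats: (a) Ito's theorem is vendored as a NAMED FACT for the compact-QED₄ (`U(1)`, Wilson action, every `β > 0`) initial data and the standard recursion only, transcribed from Ito–Seiler 2007 Thm 2.1 / eqs. (2.2)–(2.3) and Ito–Seiler 2009 §1, §3, §4(a); Ito's PRL 55 (1985) 558 (and PRL 54 (1985) 2383) were not available, so the precise class of initial coupling functions and normalisation conventions of the primary theorem are not verified here — the statement here is the special case the secondary sources state in words — and that special case is now PROVED in the tree (`MigdalKadanoffGroupBlindness_holds`, sibling file `MigdalKadanoffGroupBlindnessDischarge.lean`, whose module docstring documents the argument followed: Ito's critical-dimension local-curvature bound, CMP 110 (1987) §3 with the `SO(2)` remark of §5), so the transcription question no longer conditions the barrier theorem; (b) the barrier theorem is contingent on `AbelianDeconfinementD4` (Guth/Fröhlich–Spencer, itself vendored second-hand — see that file's `scope_caveats:` — and reduced in the tree to the printed free-boundary fact `Literature.MathematicalPhysics.QuantumFieldTheory.FrohlichSpencerU1PerimeterLawD4`, `AbelianDeconfinementD4_of_frohlichSpencer`) and on non-emptiness of `infiniteVolumeLimitPoints (d := 4) u1Rep β` (tree fact `infiniteVolumeLimitPoints_nonempty`,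 discharged as `Literature.MathematicalPhysics.QuantumLattice.infiniteVolumeLimitPoints_nonempty_holds` and fed in by the sibling file `MigdalKadanoffGroupBlindnessProofs.lean`), so that the ONLY outstanding input of `¬ MKConfinementCriterionU1D4` is `FrohlichSpencerU1PerimeterLawD4` (`MigdalKadanoffGroupBlindness.not_mkConfinementCriterionU1D4_of_frohlichSpencer`); (c) NOT formalised: Tomboulis's MKT decimations with parameters `(α, t, r)`, the interpolated exact representation, twisted partition functions `Z⁻` and vortex free energies, the inequality `Z⁻/Z ≥ Z⁻_{MKT}/Z_{MKT}`, and "`σ_tH > 0` ⇒ Wilson/Polyakov confinement" (Borgs–Seiler 1983, Tomboulis–Yaffe 1985) — consequently this file does not adjudicate whether the 2007 argument uses the non-abelian structure; it records the printed `U(1)` test that any MK-comparison argument must pass, Ito–Seiler's two printed objections (one with a proved counterexample) and Tomboulis's printed reply; (d) the `SU(N)` half of Ito's theorem (the uncontroversial direction) is not vendored; (e) `FlowsToStrongCoupling` is coefficient-wise convergence `c_j(n) → 0` for each `j ≠ 0`, as printed, not a uniform or normed statement; the convolution `conv` is a `tsum` (junk value `0` if not summable — immaterial for the smooth Wilson weight,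 whose coefficients decay faster than any power, but not proved here); (f) Kanazawa's counterexample is a counterexample to the continuation STEP as printed by Ito–Seiler, not to Tomboulis's specific function `Ψ`.
status: established (the `U(1)` test: Ito 1985 with Guth 1980 / Fröhlich–Spencer 1982, as stated in ItoSeiler2009Critical §3, §5; refutation proved here modulo the vendored facts — this fact being DISCHARGED (`MigdalKadanoffGroupBlindness_holds`) and non-emptiness proved, modulo `Literature.MathematicalPhysics.QuantumFieldTheory.FrohlichSpencerU1PerimeterLawD4` alone: `MigdalKadanoffGroupBlindness.not_mkConfinementCriterionU1D4_of_frohlichSpencer`, sibling file `MigdalKadanoffGroupBlindnessProofs.lean`); the confinement proof it constrains is an unrefereed claim [claim: Tomboulis2007Confinement, status: disputed] — dissent ItoSeiler2007Tomboulis, ItoSeiler2009Critical, Kanazawa2009Twisted; reply Tomboulis2007Reply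
[cite: ItoSeiler2007Tomboulis, §2 Thm 2.1 (p. 4)] [cite: ItoSeiler2009Critical, §1 and §3] -/
def MigdalKadanoffGroupBlindness : Prop :=
  ∀ β : ℝ, 0 < β → FlowsToStrongCoupling (u1WilsonCoeff β)

/-- **Barrier theorem (proved modulo the vendored facts).** Ito's theorem for compact QED₄ and the
weak-coupling perimeter law of `U(1)₄` refute the Migdal–Kadanoff comparison criterion: at
`β = max β₁ 0 + 1` the MK flow reaches strong coupling (this fact) yet no infinite-volume limit
state has the area law (`AbelianDeconfinementD4` with `HasPerimeterLaw.not_hasAreaLawState`) —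
"the original comparison argument … has to fail for `U(1)`". Non-emptiness of the limit-point
sets is the hypothesis `hne` (tree fact `infiniteVolumeLimitPoints_nonempty`).
[cite: ItoSeiler2009Critical, §3 and §5] -/
theorem MigdalKadanoffGroupBlindness.not_mkConfinementCriterionU1D4
    (hI : MigdalKadanoffGroupBlindness) (hA : AbelianDeconfinementD4)
    (hne : ∀ β : ℝ, (infiniteVolumeLimitPoints (d := 4) u1Rep β).Nonempty) :
    ¬ MKConfinementCriterionU1D4 := by
  intro hC
  obtain ⟨β₁, hβ⟩ := hA
  set β : ℝ := max β₁ 0 + 1 with hβdef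
  have hβ1 : β₁ < β := by rw [hβdef]; linarith [le_max_left β₁ 0]
  have hβ0 : 0 < β := by rw [hβdef]; linarith [le_max_right β₁ 0]
  obtain ⟨μ, hμ⟩ := hne β
  exact (hβ β hβ1 μ hμ).not_hasAreaLawState (hC.hasAreaLawState β hβ0 (hI β hβ0) μ hμ)

/-- The same with the non-emptiness hypothesis in the tree's packaged form
`infiniteVolumeLimitPoints_nonempty (d := 4) u1Rep`. [folklore] -/
theorem MigdalKadanoffGroupBlindness.not_mkConfinementCriterionU1D4'
    (hI : MigdalKadanoffGroupBlindness) (hA : AbelianDeconfinementD4)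
    (h : infiniteVolumeLimitPoints_nonempty (d := 4) u1Rep) :
    ¬ MKConfinementCriterionU1D4 :=
  hI.not_mkConfinementCriterionU1D4 hA (nonempty_of_infiniteVolumeLimitPoints_nonempty h)

/-- **Corollary (proved modulo the facts): at large `β` the two premises of the criterion hold
and its conclusion fails** — for some `β₁`, every `β > β₁` has an MK flow to strong coupling AND
no area law in any infinite-volume limit state of compact QED₄.
[cite: ItoSeiler2009Critical, §3] -/
theorem MigdalKadanoffGroupBlindness.exists_misleading_threshold
    (hI : MigdalKadanoffGroupBlindness) (hA : AbelianDeconfinementD4) :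
    ∃ β₁ : ℝ, 0 < β₁ ∧ ∀ β : ℝ, β₁ < β →
      FlowsToStrongCoupling (u1WilsonCoeff β) ∧
        ∀ μ ∈ infiniteVolumeLimitPoints (d := 4) u1Rep β, ¬ HasAreaLawState μ u1Character := by
  obtain ⟨β₁, hβ₁, hβ⟩ := hA.exists_threshold
  exact ⟨β₁, hβ₁, fun β hb => ⟨hI β (hβ₁.trans hb), fun μ hμ => (hβ β hb μ hμ).2⟩⟩

end Literature.Barriers.QuantumFields
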